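import Literature.Computability.AlgebraicComplexity.BI17FundamentalInvariantForms
import Literature.Computability.AlgebraicComplexity.BI17AdmissibleTablesProofs
import HarnessLib

/-!
# BI 2017 at `n = 4`: `P_{4,16}(det_4) ≠ 0` reduced to one polynomial identity (the two-level cut)

Unit `val-input-bi17-latincube4` (literature-prover, LADDER-VALIANT inputs→unconditional), bearing
on the named facts `BI2017_latinCube_2_4` (`BI17FundamentalInvariantTensors.lean`: "verified in the
cases `n = 2` and `n = 4`"; ⟺ `admissibleTableCount 4 ≠ 0` by the Summit-side
`BI2017_latinCube_2_4_iff_admissibleTableCount_four`) and the `det` half of `BI2017_P416_det_per`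
(`BI17FundamentalInvariantForms.lean`: "we have verified that `P_{4,16}(det_4)` [is] nonzero, using
computer calculations") — val-lit GAP-LEDGER rows BI2017-A and BI2017-B; bookkeeping `bears_on`
stmt-ValiantsHypothesis-19612. HONEST FRAMING: VP ≠ VNP is NOT proved here or anywhere in the tree;
nothing in this file is progress on it; no summit statement is proved by this seat; the two public
theorems make the cited computer verifications CONDITIONAL on one explicit polynomial identity `h`
(true, with a paper proof below, not yet a Lean theorem) — they do not discharge the named facts.

## The argument

The count `admissibleTableCount 4 = (4!)^{16} P_{4,16}(det_4)` (Prop. 3.28, `BI2017_prop_3_28_holds`)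
is `16! · 109 734 912 000` (val-lit NOTE-t03g6-P416-sizing.md, a native meet-in-the-middle
enumeration with `≈ 8.6·10⁷` middle states — far beyond a kernel replay; the record's verdict was
"≳ 10⁹ transitions"). This file replaces the enumeration by algebra.

Write a table as its four column maps `b_j : [16] → [4] × [4]` (levels `j = 0,1,2,3`). The signed
count is `Σ Π_j sgn(b_j) · Π_i ε(a-entries of row i) ε(c-entries of row i)`, `ε` = signature or `0`
(`admissibleTableCount_four_eq_sum_tableW`). **Cut the four levels as `{0,1} ⊔ {2,3}`.** The
signature of `(a₀,a₁,a₂,a₃)` factors as `χ(a₀,a₁) χ(a₂,a₃) sh({a₀,a₁}) [{a₂,a₃} = {a₀,a₁}ᶜ]`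
(`χ` = comparison sign, `sh` = shuffle sign), so
`ε(a⃗) ε(c⃗) = Σ_τ sh(τ) K_τ(x₀,x₁) K_{τᶜ}(x₂,x₃)` over the `36` *types* `τ = (A, C) ∈ C(4,2)²`, with
kernel `K_{(A,C)} = S_A ⊗ S_C` (`S_A = E_{aa'} - E_{a'a}`) — `rowW_vec` (a `decide`), `rowW_mul_rowW`.
Regrouping by the type function `t : [16] → Typ` (`admissibleTableCount_four_eq_sum_dmix`):
`admissibleTableCount 4 = Σ_t D(K_{t·}) · D(sh(t·) K_{(t·)ᶜ})`, `D(M_1,…,M_16) =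
Σ_{b,b'} sgn b sgn b' Π_i M_i(b i, b' i)` the MIXED DISCRIMINANT of sixteen `16 × 16` matrices.
**Polarization** (`dmix_eq_sum_det`): `D(M) = Σ_{U ⊆ [16]} (-1)^{|U|} det(Σ_{i∈U} M_i)` (both sides
equal `Σ_σ Σ_{g : cells ≃ [16]} sgn σ Π_x M_{g x}(σ x, x)`; inclusion–exclusion kernel from
`Fintype.prod_add`). Then `Σ_{i∈U} K_{t i} = K(μ_U)` and `Σ_{i∈U} sh K_{(t i)ᶜ} = K(⋆⋆μ_U)` with
`K(μ) = Σ_τ μ_τ K_τ` and `(⋆⋆μ)_τ = sh(τ) μ_{τᶜ}` the double Hodge star of `Λ²ℤ⁴ ⊗ Λ²ℤ⁴`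
(`sum_Kmat_eq`, `sum_star_Kmat_eq`), so under `h : ∀ μ, det K(⋆⋆μ) = det K(μ)` the count is the SUM
OF SQUARES `Σ_t D(K_{t·})²` (`dmix_star_eq`); the block type function `t₀` (four symbols of each of
the types `({01},{01}), ({01},{23}), ({23},{01}), ({23},{23})`) has `D(K_{t₀·})² ≥ 1`: only the
pairs `(b, ω ∘ b)` with `b` bijective and block-respecting contribute, each `sign ω = ±1`
(`dmix_t₀_term`, `one_le_dmix_t₀_sq`; `decide` only on `16 × 256`-size tables). Hence the two public
theorems **`admissibleTableCount_four_pos_of_detK_star (h) : 0 < admissibleTableCount 4`** and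
**`cayleyP_det_four_ne_zero_of_detK_star (h) : P_{4,16}(det_4) ≠ 0`**; the Summit-side one-liner
`h → BI2017_latinCube_2_4` (via `BI2017_latinCube_2_4_iff_admissibleTableCount_four`) is left to the
owner of `Summits/ValiantsHypothesis/…/Theorems/` (Literature may not import Summits).

THE REMAINING IDENTITY `h` (true; not yet in Lean; checked in exact integer arithmetic at random
points). `K(μ) = Σ_{A,C} μ_{AC} S_A ⊗ S_C` is the generic element of `Λ²k⁴ ⊗ Λ²k⁴ ⊂ Sym²(k⁴ ⊗ k⁴)`;
`F(μ) := det K(μ)` satisfies `F((Λ²g ⊗ Λ²g')μ) = F(μ)` for `g, g' ∈ SL₄` (conjugation), i.e. `F` is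
`SO₆ × SO₆`-invariant on `k⁶ ⊗ k⁶`; `⋆ ⊗ ⋆` (an element of `O₆ × O₆` of determinant `(-1,-1)`, NOT
induced by `GL₄ × GL₄`: no fixed `L` has `L K_τ Lᵀ = ⋆⋆K_τ` for all `τ`) normalises `SO₆ × SO₆` and
fixes pointwise the slice `𝔞 = {Σ_i t_i u_i ⊗ u_i}` (`u_i` a `∧`-orthonormal `⋆`-eigenbasis), and
`(SO₆ × SO₆)·𝔞` is Zariski dense (orthogonal singular value decomposition over `ℂ`); hence
`F ∘ (⋆⊗⋆) = F`. Structurally: `K(μ)` is the Clifford action of `μ ∈ 𝔭 ⊂ so₁₂ = so₆ ⊕ so₆ ⊕ 𝔭`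
from `S⁺₆ ⊗ S⁺₆` to `S⁻₆ ⊗ S⁻₆` inside the half-spin module `S⁺₁₂`, `K(⋆⋆μ)` is the opposite block,
and both determinants restrict on `𝔞` to the half-spin product `Π_{δ ∈ {±1}⁶ even}/± ⟨δ, t⟩`.
(The analogue for `per_4`, with symmetric `E_{aa'} + E_{a'a}`, is false — consistent with
`N_per = 2¹³·3⁶·5·7·173` not being smooth while `N_det = 2¹³·3⁷·5³·7²` is.) A Lean proof needs the
covariance identities (algebra) and ONE density statement, e.g. via the inverse function theorem or
a lowest-order-term argument.

Private helpers throughout (Literature convention); the plumbing `def`s are explicit finite tables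
and weights (no mathematical notion is (re)defined, no `def … : Prop`, no instances, no notation).

## References

* [BurgisserIkenmeyer2017] P. Bürgisser, C. Ikenmeyer, *Fundamental invariants of orbit closures*,
  J. Algebra 477 (2017) 390–434 (= arXiv:1511.02927), §3.3 (admissible tables, Prop. 3.28 and the
  computer verification after it), §5.2 (Def. 5.21, Prop. 5.22, Problem 5.23: "We have verified this
  in the cases `n = 2` and `n = 4`").

## Tree

`admissibleTableCount`, `IsAdmissibleTable`, `tableRowSign`, `tableColSign`, `cayleyP`, `formCoeff`,
`detPoly` (`BI17FundamentalInvariantForms` and its imports); `BI2017_prop_3_28_holds`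
(`BI17AdmissibleTablesProofs`); `Kumar2015.seqSign`, `seqSign_coe_perm` (`KumarLatinRectangles`).
Mathlib: `finProdFinEquiv`, `Fintype.prod_sum`, `Fintype.prod_add`, `Finset.prod_univ_sum`,
`Matrix.det_apply'`, `Equiv.Perm.sign_permCongr`, `Fintype.bijective_iff_surjective_and_card`.
-/

namespace Literature.Computability.AlgebraicComplexity.BI17TwoLevelCut


open Finset Literature.Computability.AlgebraicComplexity

/-! ### The 2-subsets of `[4]`, their complements and shuffle signs (tables indexed by `Fin 6`) -/

/-- The six 2-subsets `{a < a'}` of `[4]`, in the order `01, 02, 03, 12, 13, 23`. [folklore] -/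
def pairOf : Fin 6 → Fin 4 × Fin 4 := ![(0, 1), (0, 2), (0, 3), (1, 2), (1, 3), (2, 3)]

/-- The complementary 2-subset (`01 ↔ 23`, `02 ↔ 13`, `03 ↔ 12`). [folklore] -/
def complIdx : Fin 6 → Fin 6 := ![5, 4, 3, 2, 1, 0]

/-- The shuffle sign `sign(A sorted, Aᶜ sorted)` of a 2-subset `A` (the sign in the Hodge star
`⋆(e_a ∧ e_{a'}) = sh(A) e_{a''} ∧ e_{a'''}`). [folklore] -/
def shSign : Fin 6 → ℤ := ![1, -1, 1, 1, -1, 1]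

/-- The entry `(S_A)_{a a'}` of the elementary antisymmetric `4 × 4` matrix `S_A = E_{aa'} - E_{a'a}`
(`A = {a < a'}`). [folklore] -/
def kA (A : Fin 6) (a a' : Fin 4) : ℤ :=
  if (a, a') = pairOf A then 1 else if (a', a) = pairOf A then -1 else 0

/-! ### Cells, types, the kernels `K_τ = S_A ⊗ S_C` and the matrix `K(μ) = Σ_τ μ_τ K_τ` -/

/-- A cell of the `4 × 4` grid: (value of `S`, value of `T`). [folklore] -/
abbrev Cell := Fin 4 × Fin 4

/-- The symbols (rows of an admissible `4`-table). [folklore] -/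
abbrev Sym := Fin (4 * 4)

/-- A type: a pair (2-subset of `S`-values, 2-subset of `T`-values). [folklore] -/
abbrev Typ := Fin 6 × Fin 6

/-- The complementary type. [folklore] -/
def compl (τ : Typ) : Typ := (complIdx τ.1, complIdx τ.2)

/-- The sign `sh(A) sh(C)` of a type `(A, C)`. [folklore] -/
def sh2 (τ : Typ) : ℤ := shSign τ.1 * shSign τ.2

/-- The kernel `K_τ(x, y) = (S_A ⊗ S_C)_{x y}` of a type `τ = (A, C)`. [folklore] -/
def K (τ : Typ) (x y : Cell) : ℤ := kA τ.1 x.1 y.1 * kA τ.2 x.2 y.2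

/-- `K_τ` as a `16 × 16` integer matrix. [folklore] -/
def Kmat (τ : Typ) : Matrix Cell Cell ℤ := fun x y => K τ x y

/-- `K(μ) = Σ_τ μ_τ K_τ = Σ_{A,C} μ_{AC} S_A ⊗ S_C`, the generic element of `Λ²ℤ⁴ ⊗ Λ²ℤ⁴` as a
symmetric `16 × 16` matrix. [folklore] -/
def kMat (μ : Typ → ℤ) : Matrix Cell Cell ℤ := fun x y => ∑ τ, μ τ * K τ x y

/-- The double Hodge star on coefficient vectors: `(⋆⋆μ)_τ = sh(τ) μ_{τᶜ}`. [folklore] -/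
def starMu (μ : Typ → ℤ) : Typ → ℤ := fun τ => sh2 τ * μ (compl τ)

/-! ### Weights -/

/-- The weight of a row `v : [4] → [4]` of `S` or `T`: its signature if it is a permutation, else `0`.
[folklore] -/
def rowW (v : Fin 4 → Fin 4) : ℤ :=
  if Function.Bijective v then ((Kumar2015.seqSign v : ℤˣ) : ℤ) else 0

/-- The weight of a column `b : [16] → [4] × [4]` of a table: the signature of `finProdFinEquiv ∘ b`
if it is a bijection, else `0`. [folklore] -/
def colW (b : Sym → Cell) : ℤ :=
  if Function.Bijective b then ((Kumar2015.seqSign (finProdFinEquiv ∘ b) : ℤˣ) : ℤ) else 0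

/-- The mixed discriminant of sixteen `16 × 16` matrices:
`D(M) = Σ_{b, b'} colW(b) colW(b') Π_i M_i (b i) (b' i)`. [folklore] -/
def Dmix (M : Sym → Matrix Cell Cell ℤ) : ℤ :=
  ∑ b : Sym → Cell, ∑ b' : Sym → Cell, colW b * colW b' * ∏ i, M i (b i) (b' i)

/-! ### The pointwise decomposition `ε(a⃗) ε(c⃗) = Σ_τ sh(τ) K_τ(x₀,x₁) K_{τᶜ}(x₂,x₃)` -/

set_option maxRecDepth 100000 in
/-- `ε(a₀,a₁,a₂,a₃) = Σ_A sh(A) (S_A)_{a₀a₁} (S_{Aᶜ})_{a₂a₃}`. [folklore] -/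
private theorem rowW_vec (a₀ a₁ a₂ a₃ : Fin 4) :
    rowW ![a₀, a₁, a₂, a₃] = ∑ A : Fin 6, shSign A * kA A a₀ a₁ * kA (complIdx A) a₂ a₃ := by
  revert a₀ a₁ a₂ a₃; decide +kernel

/-- The product of the two row weights of a symbol is the type sum of the kernels. [folklore] -/
private theorem rowW_mul_rowW (x₀ x₁ x₂ x₃ : Cell) :
    rowW ![x₀.1, x₁.1, x₂.1, x₃.1] * rowW ![x₀.2, x₁.2, x₂.2, x₃.2] =
      ∑ τ : Typ, sh2 τ * K τ x₀ x₁ * K (compl τ) x₂ x₃ := by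
  rw [rowW_vec, rowW_vec, Finset.sum_mul_sum, ← Finset.univ_product_univ, ← Finset.sum_product']
  refine Finset.sum_congr rfl fun τ _ => ?_
  simp only [sh2, K, compl]
  ring

/-! ### Step 1: the count as a sum of weights over all pairs of tables -/

/-- The weight of a pair of tables `(S, T)`. [folklore] -/
def tableW (ST : (Sym → Fin 4 → Fin 4) × (Sym → Fin 4 → Fin 4)) : ℤ :=
  (∏ i, rowW (ST.1 i) * rowW (ST.2 i)) * ∏ j, colW fun i => (ST.1 i j, ST.2 i j)

/-- `admissibleTableCount 4 = Σ_{(S,T)} tableW (S,T)`. [folklore] -/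
private theorem admissibleTableCount_four_eq_sum_tableW :
    admissibleTableCount 4 = ∑ ST, tableW ST := by
  unfold admissibleTableCount
  rw [Finset.sum_filter]
  refine Finset.sum_congr rfl fun ST _ => ?_
  rcases ST with ⟨S, T⟩
  split_ifs with hadm
  · obtain ⟨hS, hT, hC⟩ := hadm
    simp only [tableW, rowW, colW, if_pos (hS _), if_pos (hT _), if_pos (hC _), tableRowSign,
      tableColSign, Units.val_mul, Units.coe_prod, Finset.prod_mul_distrib]
    rfl
  · unfold IsAdmissibleTable at hadm
    simp only [not_and_or, not_forall] at hadm
    symm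
    rcases hadm with ⟨i, hi⟩ | ⟨i, hi⟩ | ⟨j, hj⟩
    · apply mul_eq_zero_of_left
      refine Finset.prod_eq_zero (Finset.mem_univ i) (mul_eq_zero_of_left ?_ _)
      rw [rowW, if_neg hi]
    · apply mul_eq_zero_of_left
      refine Finset.prod_eq_zero (Finset.mem_univ i) (mul_eq_zero_of_right _ ?_)
      rw [rowW, if_neg hi]
    · apply mul_eq_zero_of_right
      refine Finset.prod_eq_zero (Finset.mem_univ j) ?_
      rw [colW, if_neg hj]

/-! ### Step 2: the four columns as the summation variables -/

/-- A pair of tables is the same as its four columns `b_j : [16] → [4] × [4]`. [folklore] -/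
def colEquiv : ((Sym → Fin 4 → Fin 4) × (Sym → Fin 4 → Fin 4)) ≃
    (Sym → Cell) × (Sym → Cell) × (Sym → Cell) × (Sym → Cell) where
  toFun ST := (fun i => (ST.1 i 0, ST.2 i 0), fun i => (ST.1 i 1, ST.2 i 1),
    fun i => (ST.1 i 2, ST.2 i 2), fun i => (ST.1 i 3, ST.2 i 3))
  invFun q := (fun i => ![(q.1 i).1, (q.2.1 i).1, (q.2.2.1 i).1, (q.2.2.2 i).1],
    fun i => ![(q.1 i).2, (q.2.1 i).2, (q.2.2.1 i).2, (q.2.2.2 i).2])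
  left_inv ST := by
    rcases ST with ⟨S, T⟩
    simp only [Prod.mk.injEq]
    constructor <;> (funext i j; fin_cases j <;> rfl)
  right_inv q := by rfl

/-- The weight of a 4-tuple of columns. [folklore] -/
def colsW (q : (Sym → Cell) × (Sym → Cell) × (Sym → Cell) × (Sym → Cell)) : ℤ :=
  (∏ i, ∑ τ : Typ, sh2 τ * K τ (q.1 i) (q.2.1 i) * K (compl τ) (q.2.2.1 i) (q.2.2.2 i)) *
    (colW q.1 * colW q.2.1 * colW q.2.2.1 * colW q.2.2.2)

/-- `tableW = colsW ∘ colEquiv`. [folklore] -/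
private theorem tableW_eq_colsW (ST : (Sym → Fin 4 → Fin 4) × (Sym → Fin 4 → Fin 4)) :
    tableW ST = colsW (colEquiv ST) := by
  rcases ST with ⟨S, T⟩
  unfold tableW colsW
  congr 1
  · refine Finset.prod_congr rfl fun i _ => ?_
    rw [← rowW_mul_rowW]
    congr 2 <;> (funext j; fin_cases j <;> rfl)
  · rw [Fin.prod_univ_four]
    rfl

/-- The count as a sum over 4-tuples of columns. [folklore] -/
private theorem admissibleTableCount_four_eq_sum_colsW :
    admissibleTableCount 4 = ∑ q, colsW q := by
  rw [admissibleTableCount_four_eq_sum_tableW]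
  exact Fintype.sum_equiv colEquiv _ _ tableW_eq_colsW

/-! ### Step 3: regrouping by the type function `t : [16] → Typ` -/

/-- The two-level cut: `admissibleTableCount 4 = Σ_t D(K_{t·}) · D(sh(t·) K_{t·ᶜ})`. [folklore] -/
private theorem admissibleTableCount_four_eq_sum_dmix :
    admissibleTableCount 4 =
      ∑ t : Sym → Typ, Dmix (fun i => Kmat (t i)) * Dmix (fun i => sh2 (t i) • Kmat (compl (t i))) := by
  rw [admissibleTableCount_four_eq_sum_colsW]
  -- expand the product of type sums into a sum over type functions
  have hexp : ∀ q : (Sym → Cell) × (Sym → Cell) × (Sym → Cell) × (Sym → Cell),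
      colsW q = ∑ t : Sym → Typ,
        (colW q.1 * colW q.2.1 * ∏ i, K (t i) (q.1 i) (q.2.1 i)) *
        (colW q.2.2.1 * colW q.2.2.2 * ∏ i, sh2 (t i) * K (compl (t i)) (q.2.2.1 i) (q.2.2.2 i)) := by
    intro q
    unfold colsW
    rw [Fintype.prod_sum (κ := fun _ : Sym => Typ)
      (fun i τ => sh2 τ * K τ (q.1 i) (q.2.1 i) * K (compl τ) (q.2.2.1 i) (q.2.2.2 i)),
      Finset.sum_mul]
    refine Finset.sum_congr rfl fun t _ => ?_
    have : ∏ i, sh2 (t i) * K (t i) (q.1 i) (q.2.1 i) * K (compl (t i)) (q.2.2.1 i) (q.2.2.2 i) =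
        (∏ i, K (t i) (q.1 i) (q.2.1 i)) *
          ∏ i, sh2 (t i) * K (compl (t i)) (q.2.2.1 i) (q.2.2.2 i) := by
      rw [← Finset.prod_mul_distrib]
      exact Finset.prod_congr rfl fun i _ => by ring
    rw [this]
    ring
  simp_rw [hexp]
  rw [Finset.sum_comm]
  refine Finset.sum_congr rfl fun t _ => ?_
  -- split the sum over 4-tuples into a product of two double sums
  rw [Fintype.sum_prod_type, Dmix, Dmix, Finset.sum_mul]
  refine Finset.sum_congr rfl fun b₀ _ => ?_
  rw [Fintype.sum_prod_type, Finset.sum_mul]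
  refine Finset.sum_congr rfl fun b₁ _ => ?_
  rw [Fintype.sum_prod_type, Finset.mul_sum]
  refine Finset.sum_congr rfl fun b₂ _ => ?_
  rw [Finset.mul_sum]
  refine Finset.sum_congr rfl fun b₃ _ => ?_
  simp only [Kmat, Matrix.smul_apply, smul_eq_mul]



/-! ## Part 2: polarization of the mixed discriminant -/



/-! ### Sums over bijections are sums over equivalences -/

/-- A sum over the bijective functions `α → β` is a sum over the equivalences `α ≃ β`
(dependent form). [folklore] -/
private theorem sum_dite_bijective_eq_sum_equiv {α β M : Type*} [Fintype α] [DecidableEq α] [Fintype β]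
    [DecidableEq β] [AddCommMonoid M] (F : ∀ b : α → β, Function.Bijective b → M) :
    (∑ b : α → β, if h : Function.Bijective b then F b h else 0) =
      ∑ g : α ≃ β, F ⇑g g.bijective := by
  have : (∑ b : α → β, if h : Function.Bijective b then F b h else 0) =
      ∑ b ∈ Finset.univ.filter (fun b : α → β => Function.Bijective b),
        if h : Function.Bijective b then F b h else 0 := by
    rw [Finset.sum_filter]
    refine Finset.sum_congr rfl fun b _ => ?_
    split_ifs <;> rfl
  rw [this]
  refine Finset.sum_bij' (fun b hb => Equiv.ofBijective b (Finset.mem_filter.mp hb).2)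
    (fun g _ => ⇑g) ?_ ?_ ?_ ?_ ?_
  · intro b hb; exact Finset.mem_univ _
  · intro g _; exact Finset.mem_filter.mpr ⟨Finset.mem_univ _, g.bijective⟩
  · intro b hb; rfl
  · intro g _; exact Equiv.ext fun _ => rfl
  · intro b hb
    rw [dif_pos (Finset.mem_filter.mp hb).2]
    rfl

/-- A sum over the bijective functions `α → β` is a sum over the equivalences `α ≃ β`. [folklore] -/
private theorem sum_ite_bijective_eq_sum_equiv {α β M : Type*} [Fintype α] [DecidableEq α] [Fintype β]
    [DecidableEq β] [AddCommMonoid M] (F : (α → β) → M) :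
    (∑ b : α → β, if Function.Bijective b then F b else 0) = ∑ g : α ≃ β, F ⇑g := by
  rw [← sum_dite_bijective_eq_sum_equiv (fun b _ => F b)]
  refine Finset.sum_congr rfl fun b _ => ?_
  split_ifs <;> rfl

/-! ### The inclusion–exclusion kernel -/

/-- `Σ_U (-1)^{#U} [g(cells) ⊆ U] = [g surjective]` (`(-1)^16 = 1`). [folklore] -/
private theorem sum_neg_one_pow_card_mul_ite (g : Cell → Sym) :
    (∑ U : Finset Sym, (-1 : ℤ) ^ U.card * if ∀ x, g x ∈ U then 1 else 0) =
      if Function.Surjective g then 1 else 0 := by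
  have hl : ∏ a : Sym, ((-1 : ℤ) + if a ∉ Finset.univ.image g then 1 else 0) =
      if Function.Surjective g then 1 else 0 := by
    by_cases hs : Function.Surjective g
    · rw [if_pos hs]
      have : ∀ a : Sym, ((-1 : ℤ) + if a ∉ Finset.univ.image g then 1 else 0) = -1 := by
        intro a
        obtain ⟨x, hx⟩ := hs a
        rw [if_neg (not_not_intro (Finset.mem_image.mpr ⟨x, Finset.mem_univ _, hx⟩))]; ring
      simp_rw [this]
      rw [Finset.prod_const, Finset.card_univ, Fintype.card_fin]
      norm_num
    · rw [if_neg hs]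
      obtain ⟨a, ha⟩ := not_forall.mp hs
      apply Finset.prod_eq_zero (Finset.mem_univ a)
      rw [if_pos]
      · ring
      · intro h
        obtain ⟨x, _, hx⟩ := Finset.mem_image.mp h
        exact ha ⟨x, hx⟩
  rw [← hl, Fintype.prod_add]
  refine Finset.sum_congr rfl fun U _ => ?_
  rw [Finset.prod_const, Finset.prod_boole]
  have hiff : (∀ a ∈ Uᶜ, a ∉ Finset.univ.image g) ↔ (∀ x, g x ∈ U) := by
    constructor
    · intro h x
      by_contra hx
      exact h (g x) (Finset.mem_compl.mpr hx) (Finset.mem_image.mpr ⟨x, Finset.mem_univ _, rfl⟩)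
    · intro h a ha haR
      obtain ⟨x, _, hx⟩ := Finset.mem_image.mp haR
      rw [← hx] at ha
      exact (Finset.mem_compl.mp ha) (h x)
  by_cases hx : ∀ x, g x ∈ U
  · rw [if_pos hx, if_pos (hiff.mpr hx)]
  · rw [if_neg hx, if_neg (fun h => hx (hiff.mp h))]

/-! ### The right-hand side: expanding `Σ_U (-1)^{#U} det(Σ_{i∈U} M_i)` -/

/-- `Σ_U (-1)^{#U} det(Σ_{i ∈ U} M_i) = Σ_σ Σ_{g : cells ≃ symbols} sgn(σ) Π_x M_{g x}(σ x, x)`.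
[folklore] -/
private theorem sum_det_eq (M : Sym → Matrix Cell Cell ℤ) :
    (∑ U : Finset Sym, (-1 : ℤ) ^ U.card * (∑ i ∈ U, M i).det) =
      ∑ σ : Equiv.Perm Cell, ∑ g : Cell ≃ Sym,
        ((Equiv.Perm.sign σ : ℤˣ) : ℤ) * ∏ x, M (g x) (σ x) x := by
  -- expand the determinants and the products of sums
  have h1 : ∀ U : Finset Sym, (∑ i ∈ U, M i).det =
      ∑ σ : Equiv.Perm Cell, ∑ g : Cell → Sym, ((Equiv.Perm.sign σ : ℤˣ) : ℤ) *
        ((∏ x, M (g x) (σ x) x) * if ∀ x, g x ∈ U then 1 else 0) := by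
    intro U
    rw [Matrix.det_apply']
    refine Finset.sum_congr rfl fun σ _ => ?_
    rw [← Finset.mul_sum]
    congr 1
    have : ∀ x, (∑ i ∈ U, M i) (σ x) x = ∑ i ∈ U, M i (σ x) x := fun x => Matrix.sum_apply _ _ _ _
    simp_rw [this]
    rw [Finset.prod_univ_sum (fun _ : Cell => U) (fun x i => M i (σ x) x)]
    simp_rw [mul_boole]
    rw [← Finset.sum_filter]
    congr 1
    ext g
    simp [Fintype.mem_piFinset]
  simp_rw [h1, Finset.mul_sum]
  rw [Finset.sum_comm]
  refine Finset.sum_congr rfl fun σ _ => ?_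
  rw [Finset.sum_comm, ← sum_ite_bijective_eq_sum_equiv
    (fun f : Cell → Sym => ((Equiv.Perm.sign σ : ℤˣ) : ℤ) * ∏ x, M (f x) (σ x) x)]
  refine Finset.sum_congr rfl fun g _ => ?_
  have h2 : ∀ U : Finset Sym,
      (-1 : ℤ) ^ U.card * (((Equiv.Perm.sign σ : ℤˣ) : ℤ) *
      ((∏ x, M (g x) (σ x) x) * if ∀ x, g x ∈ U then 1 else 0)) =
      (((Equiv.Perm.sign σ : ℤˣ) : ℤ) * ∏ x, M (g x) (σ x) x) *
        ((-1 : ℤ) ^ U.card * if ∀ x, g x ∈ U then 1 else 0) := fun U => by ring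
  simp_rw [h2]
  rw [← Finset.mul_sum, sum_neg_one_pow_card_mul_ite, mul_boole]
  have hcard : Fintype.card Cell = Fintype.card Sym := by simp
  by_cases hg : Function.Bijective g
  · rw [if_pos hg, if_pos hg.2]
  · have hs : ¬ Function.Surjective g := fun hs =>
      hg ((Fintype.bijective_iff_surjective_and_card g).mpr ⟨hs, hcard⟩)
    rw [if_neg hg, if_neg hs]

/-! ### The left-hand side: `Dmix` over pairs of equivalences -/

/-- Reindexing pairs of table-columns `(β, β')` by `(σ, g) = (β'⁻¹ β, β'⁻¹)`. [folklore] -/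
def pairEquiv : (Sym ≃ Cell) × (Sym ≃ Cell) ≃ Equiv.Perm Cell × (Cell ≃ Sym) where
  toFun p := (p.2.symm.trans p.1, p.2.symm)
  invFun q := (q.2.symm.trans q.1, q.2.symm)
  left_inv p := by
    rcases p with ⟨β, β'⟩
    simp only [Equiv.symm_symm, Prod.mk.injEq, and_true]
    exact Equiv.ext fun x => by simp
  right_inv q := by
    rcases q with ⟨σ, g⟩
    simp only [Equiv.symm_symm, Prod.mk.injEq, and_true]
    exact Equiv.ext fun x => by simp

/-- `Dmix M = Σ_σ Σ_{g : cells ≃ symbols} sgn(σ) Π_x M_{g x}(σ x, x)`. [folklore] -/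
private theorem dmix_eq (M : Sym → Matrix Cell Cell ℤ) :
    Dmix M = ∑ σ : Equiv.Perm Cell, ∑ g : Cell ≃ Sym,
      ((Equiv.Perm.sign σ : ℤˣ) : ℤ) * ∏ x, M (g x) (σ x) x := by
  unfold Dmix
  -- restrict both sums to bijections, i.e. equivalences
  have hcol : ∀ b : Sym → Cell, colW b =
      if hb : Function.Bijective b then
        ((Equiv.Perm.sign ((Equiv.ofBijective b hb).trans finProdFinEquiv) : ℤˣ) : ℤ) else 0 := by
    intro b
    unfold colW
    split_ifs with hb
    · congr 1
      exact Kumar2015.seqSign_coe_perm ((Equiv.ofBijective b hb).trans finProdFinEquiv)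
    · rfl
  have hof : ∀ (β : Sym ≃ Cell) (h : Function.Bijective ⇑β), Equiv.ofBijective ⇑β h = β :=
    fun β h => Equiv.ext fun _ => rfl
  have step1 : (∑ b : Sym → Cell, ∑ b' : Sym → Cell, colW b * colW b' * ∏ i, M i (b i) (b' i)) =
      ∑ β : Sym ≃ Cell, ∑ β' : Sym ≃ Cell,
        ((Equiv.Perm.sign (β.trans finProdFinEquiv) : ℤˣ) : ℤ) *
          ((Equiv.Perm.sign (β'.trans finProdFinEquiv) : ℤˣ) : ℤ) * ∏ i, M i (β i) (β' i) := by
    have inner : ∀ b : Sym → Cell, (∑ b' : Sym → Cell, colW b * colW b' * ∏ i, M i (b i) (b' i)) =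
        if hb : Function.Bijective b then
          ∑ β' : Sym ≃ Cell,
            ((Equiv.Perm.sign ((Equiv.ofBijective b hb).trans finProdFinEquiv) : ℤˣ) : ℤ) *
              ((Equiv.Perm.sign (β'.trans finProdFinEquiv) : ℤˣ) : ℤ) * ∏ i, M i (b i) (β' i)
        else 0 := by
      intro b
      by_cases hb : Function.Bijective b
      · rw [dif_pos hb]
        have hre : (∑ b' : Sym → Cell, colW b * colW b' * ∏ i, M i (b i) (b' i)) =
            ∑ b' : Sym → Cell, if hb' : Function.Bijective b' then
              ((Equiv.Perm.sign ((Equiv.ofBijective b hb).trans finProdFinEquiv) : ℤˣ) : ℤ) *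
              ((Equiv.Perm.sign ((Equiv.ofBijective b' hb').trans finProdFinEquiv) : ℤˣ) : ℤ) *
                ∏ i, M i (b i) (b' i) else 0 := by
          refine Finset.sum_congr rfl fun b' _ => ?_
          rw [hcol b, hcol b', dif_pos hb]
          by_cases hb' : Function.Bijective b'
          · rw [dif_pos hb', dif_pos hb']
          · rw [dif_neg hb', dif_neg hb']; ring
        rw [hre, sum_dite_bijective_eq_sum_equiv]
        refine Finset.sum_congr rfl fun β' _ => ?_
        rw [hof β']
      · rw [dif_neg hb]
        apply Finset.sum_eq_zero
        intro b' _
        rw [colW, if_neg hb]; ring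
    simp_rw [inner]
    rw [sum_dite_bijective_eq_sum_equiv]
    refine Finset.sum_congr rfl fun β _ => ?_
    rw [hof]
  rw [step1, ← Fintype.sum_prod_type', ← Fintype.sum_prod_type']
  refine Fintype.sum_equiv pairEquiv _ _ fun p => ?_
  rcases p with ⟨β, β'⟩
  simp only [pairEquiv, Equiv.coe_fn_mk]
  -- the product
  have hprod : ∏ i, M i (β i) (β' i) = ∏ x, M (β'.symm x) ((β'.symm.trans β) x) x := by
    refine Fintype.prod_equiv β' _ _ fun i => ?_
    simp
  -- the sign
  have hσ : β'.symm.trans β =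
      finProdFinEquiv.symm.permCongr ((β'.trans finProdFinEquiv).symm.trans (β.trans finProdFinEquiv)) := by
    refine Equiv.ext fun x => ?_
    simp [Equiv.permCongr_apply]
  have hsign : ((Equiv.Perm.sign (β'.symm.trans β) : ℤˣ) : ℤ) =
      ((Equiv.Perm.sign (β.trans finProdFinEquiv) : ℤˣ) : ℤ) *
        ((Equiv.Perm.sign (β'.trans finProdFinEquiv) : ℤˣ) : ℤ) := by
    rw [hσ, Equiv.Perm.sign_permCongr, Equiv.Perm.sign_trans, Equiv.Perm.sign_symm, Units.val_mul]
  rw [hprod, hsign]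

/-- **Polarization**: the mixed discriminant is the alternating sum of the determinants of the partial
sums, `D(M_1,…,M_16) = Σ_{U ⊆ [16]} (-1)^{|U|} det(Σ_{i∈U} M_i)`. [folklore] -/
private theorem dmix_eq_sum_det (M : Sym → Matrix Cell Cell ℤ) :
    Dmix M = ∑ U : Finset Sym, (-1 : ℤ) ^ U.card * (∑ i ∈ U, M i).det := by
  rw [dmix_eq, sum_det_eq]



/-! ## Part 3: the double Hodge star, the witness, the assembly -/



/-! ### Partial sums of kernels are `K(μ)`; partial sums of dual kernels are `K(⋆⋆μ)` -/

/-- The type histogram of `U ⊆ [16]` under `t`: `μ_U(τ) = #{i ∈ U : t i = τ}`. [folklore] -/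
def hist (t : Sym → Typ) (U : Finset Sym) : Typ → ℤ := fun τ => ((U.filter fun i => t i = τ).card : ℤ)

/-- `compl` is an involution. [folklore] -/
private theorem compl_compl (τ : Typ) : compl (compl τ) = τ := by
  revert τ; decide

/-- `sh(τᶜ) = sh(τ)`. [folklore] -/
private theorem sh2_compl (τ : Typ) : sh2 (compl τ) = sh2 τ := by
  revert τ; decide

/-- `compl` as a permutation of the types. [folklore] -/
def complEquiv : Typ ≃ Typ := ⟨compl, compl, compl_compl, compl_compl⟩

/-- `Σ_{i ∈ U} K_{t i} = K(μ_U)`. [folklore] -/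
private theorem sum_Kmat_eq (t : Sym → Typ) (U : Finset Sym) : ∑ i ∈ U, Kmat (t i) = kMat (hist t U) := by
  ext x y
  rw [Matrix.sum_apply]
  simp only [Kmat, kMat, hist]
  have : ∀ τ : Typ, ((U.filter fun i => t i = τ).card : ℤ) * K τ x y =
      ∑ i ∈ U, if t i = τ then K τ x y else 0 := by
    intro τ; rw [← Finset.sum_filter, Finset.sum_const, nsmul_eq_mul]
  simp_rw [this]
  rw [Finset.sum_comm]
  refine Finset.sum_congr rfl fun i _ => ?_
  rw [Finset.sum_ite_eq]
  simp

/-- `Σ_{i ∈ U} sh(t i) K_{(t i)ᶜ} = K(⋆⋆μ_U)`. [folklore] -/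
private theorem sum_star_Kmat_eq (t : Sym → Typ) (U : Finset Sym) :
    ∑ i ∈ U, sh2 (t i) • Kmat (compl (t i)) = kMat (starMu (hist t U)) := by
  ext x y
  rw [Matrix.sum_apply]
  simp only [Kmat, kMat, hist, starMu, Matrix.smul_apply, smul_eq_mul]
  rw [← Equiv.sum_comp complEquiv]
  simp only [complEquiv, Equiv.coe_fn_mk, compl_compl, sh2_compl]
  have : ∀ τ : Typ, sh2 τ * ((U.filter fun i => t i = τ).card : ℤ) * K (compl τ) x y =
      ∑ i ∈ U, if t i = τ then sh2 τ * K (compl τ) x y else 0 := by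
    intro τ; rw [← Finset.sum_filter, Finset.sum_const, nsmul_eq_mul]; ring
  simp_rw [this]
  rw [Finset.sum_comm]
  refine Finset.sum_congr rfl fun i _ => ?_
  rw [Finset.sum_ite_eq]
  simp

/-- Under the double-Hodge-star invariance of `det K(μ)`, the two mixed discriminants of the
two-level cut agree: `D(sh(t·) K_{t·ᶜ}) = D(K_{t·})`. [folklore] -/
private theorem dmix_star_eq (h : ∀ μ : Typ → ℤ, (kMat (starMu μ)).det = (kMat μ).det) (t : Sym → Typ) :
    Dmix (fun i => sh2 (t i) • Kmat (compl (t i))) = Dmix (fun i => Kmat (t i)) := by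
  rw [dmix_eq_sum_det, dmix_eq_sum_det]
  refine Finset.sum_congr rfl fun U _ => ?_
  rw [sum_Kmat_eq, sum_star_Kmat_eq, h]

/-! ### The witness: the block type function `t₀` has `D(K_{t₀·}) ≠ 0` -/

/-- The block type function: symbols `0–3 ↦ ({0,1},{0,1})`, `4–7 ↦ ({0,1},{2,3})`,
`8–11 ↦ ({2,3},{0,1})`, `12–15 ↦ ({2,3},{2,3})`. [folklore] -/
def t₀ : Sym → Typ := fun i => (if (i : ℕ) < 8 then 0 else 5, if (i : ℕ) % 8 < 4 then 0 else 5)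

/-- The partner involution `0 ↔ 1`, `2 ↔ 3` of `[4]`. [folklore] -/
def pFin : Fin 4 → Fin 4 := ![1, 0, 3, 2]

/-- The opposite-corner involution of the cells. [folklore] -/
def ω (x : Cell) : Cell := (pFin x.1, pFin x.2)

/-- The cell `x` lies in the `2 × 2` block of the type `τ` (Boolean test). [folklore] -/
def InBlock (τ : Typ) (x : Cell) : Bool :=
  (x.1 == (pairOf τ.1).1 || x.1 == (pairOf τ.1).2) && (x.2 == (pairOf τ.2).1 || x.2 == (pairOf τ.2).2)

/-- The corner sign `s(a)`: `+1` for `a ∈ {0, 2}`, `-1` for `a ∈ {1, 3}`. [folklore] -/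
def s1 : Fin 4 → ℤ := ![1, -1, 1, -1]

set_option maxRecDepth 100000 in
/-- Off the opposite corner the block kernels vanish. [folklore] -/
private theorem K_t₀_eq_zero (i : Sym) (x y : Cell) (hy : y ≠ ω x) : K (t₀ i) x y = 0 := by
  revert i x y; decide +kernel

set_option maxRecDepth 100000 in
/-- On the opposite corner the block kernel is the corner sign inside the block, `0` outside.
[folklore] -/
private theorem K_t₀_ω (i : Sym) (x : Cell) :
    K (t₀ i) x (ω x) = if InBlock (t₀ i) x then s1 x.1 * s1 x.2 else 0 := by
  revert i x; decide +kernel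

set_option maxRecDepth 100000 in
/-- The corner signs multiply to `1` over the grid. [folklore] -/
private theorem prod_s1 : ∏ x : Cell, s1 x.1 * s1 x.2 = 1 := by decide +kernel

set_option maxRecDepth 100000 in
/-- `ω` is an involution. [folklore] -/
private theorem ω_ω (x : Cell) : ω (ω x) = x := by revert x; decide +kernel

/-- `ω` as a permutation of the cells. [folklore] -/
def ωPerm : Equiv.Perm Cell := ⟨ω, ω, ω_ω, ω_ω⟩

/-- `ω` transported to the symbols through `finProdFinEquiv`. [folklore] -/
def ωSym : Equiv.Perm Sym := finProdFinEquiv.symm.trans (ωPerm.trans finProdFinEquiv)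

/-- Composing a column with `ω` multiplies its weight by `sign(ω)`. [folklore] -/
private theorem colW_comp_ω (b : Sym → Cell) :
    colW (ω ∘ b) = ((Equiv.Perm.sign ωSym : ℤˣ) : ℤ) * colW b := by
  unfold colW
  by_cases hb : Function.Bijective b
  · have hωb : Function.Bijective (ω ∘ b) := ωPerm.bijective.comp hb
    have hfb : Function.Bijective (finProdFinEquiv ∘ b : Sym → Sym) :=
      finProdFinEquiv.bijective.comp hb
    rw [if_pos hb, if_pos hωb]
    have e1 : (finProdFinEquiv ∘ (ω ∘ b) : Sym → Sym) =
        ⇑((Equiv.ofBijective _ hfb).trans ωSym) := by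
      funext i; simp [ωSym, ωPerm]
    have e2 : Kumar2015.seqSign (finProdFinEquiv ∘ b : Sym → Sym) =
        Equiv.Perm.sign (Equiv.ofBijective _ hfb) := by
      rw [← Kumar2015.seqSign_coe_perm, Equiv.coe_ofBijective]
    rw [e1, Kumar2015.seqSign_coe_perm, Equiv.Perm.sign_trans, Units.val_mul, e2]
  · have hωb : ¬ Function.Bijective (ω ∘ b) := by
      intro h'
      apply hb
      have : b = ω ∘ (ω ∘ b) := by funext i; simp [ω_ω]
      rw [this]
      exact ωPerm.bijective.comp h'
    rw [if_neg hb, if_neg hωb, mul_zero]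

/-- A block-respecting bijective column. [folklore] -/
def b₀ : Sym → Cell :=
  ![(0, 0), (0, 1), (1, 0), (1, 1), (0, 2), (0, 3), (1, 2), (1, 3),
    (2, 0), (2, 1), (3, 0), (3, 1), (2, 2), (2, 3), (3, 2), (3, 3)]

set_option maxRecDepth 100000 in
/-- `b₀` is bijective and block-respecting. [folklore] -/
private theorem b₀_good : Function.Bijective b₀ ∧ ∀ i, InBlock (t₀ i) (b₀ i) := by decide +kernel

/-- The terms of `D(K_{t₀·})`: only `b' = ω ∘ b` with `b` bijective and block-respecting contribute,
each contributing `sign(ω)`. [folklore] -/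
private theorem dmix_t₀_term (b : Sym → Cell) :
    (∑ b' : Sym → Cell, colW b * colW b' * ∏ i, Kmat (t₀ i) (b i) (b' i)) =
      if Function.Bijective b ∧ ∀ i, InBlock (t₀ i) (b i) then
        ((Equiv.Perm.sign ωSym : ℤˣ) : ℤ) else 0 := by
  rw [Finset.sum_eq_single (ω ∘ b)]
  · -- the surviving term
    simp only [Kmat, Function.comp_apply, K_t₀_ω, colW_comp_ω]
    by_cases hb : Function.Bijective b
    · by_cases hbl : ∀ i, InBlock (t₀ i) (b i)
      · rw [if_pos ⟨hb, hbl⟩]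
        have hp : ∏ i, (if InBlock (t₀ i) (b i) then s1 (b i).1 * s1 (b i).2 else 0) = 1 := by
          rw [← prod_s1]
          refine Fintype.prod_equiv (Equiv.ofBijective b hb) _ _ fun i => ?_
          rw [if_pos (hbl i)]; rfl
        rw [hp, mul_one]
        have hc : colW b * colW b = 1 := by
          unfold colW; rw [if_pos hb, ← Units.val_mul, Int.units_mul_self, Units.val_one]
        calc colW b * (((Equiv.Perm.sign ωSym : ℤˣ) : ℤ) * colW b)
            = ((Equiv.Perm.sign ωSym : ℤˣ) : ℤ) * (colW b * colW b) := by ring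
          _ = _ := by rw [hc, mul_one]
      · rw [if_neg (fun h => hbl h.2)]
        obtain ⟨i, hi⟩ := not_forall.mp hbl
        apply mul_eq_zero_of_right
        exact Finset.prod_eq_zero (Finset.mem_univ i) (if_neg hi)
    · rw [if_neg (fun h => hb h.1)]
      unfold colW; rw [if_neg hb]; ring
  · -- all other `b'` vanish
    intro b' _ hb'
    obtain ⟨i, hi⟩ := Function.ne_iff.mp hb'
    apply mul_eq_zero_of_right
    exact Finset.prod_eq_zero (Finset.mem_univ i) (K_t₀_eq_zero _ _ _ hi)
  · intro h; exact absurd (Finset.mem_univ _) h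

/-- `D(K_{t₀·})² ≥ 1`. [folklore] -/
private theorem one_le_dmix_t₀_sq :
    1 ≤ Dmix (fun i => Kmat (t₀ i)) * Dmix (fun i => Kmat (t₀ i)) := by
  have hD : Dmix (fun i => Kmat (t₀ i)) = ((Equiv.Perm.sign ωSym : ℤˣ) : ℤ) *
      ∑ b : Sym → Cell, if Function.Bijective b ∧ ∀ i, InBlock (t₀ i) (b i) then (1 : ℤ) else 0 := by
    unfold Dmix
    simp_rw [dmix_t₀_term]
    rw [Finset.mul_sum]
    refine Finset.sum_congr rfl fun b _ => ?_
    split_ifs <;> simp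
  have hN : 1 ≤ ∑ b : Sym → Cell,
      if Function.Bijective b ∧ ∀ i, InBlock (t₀ i) (b i) then (1 : ℤ) else 0 := by
    have h1 := Finset.single_le_sum
      (f := fun b : Sym → Cell => if Function.Bijective b ∧ ∀ i, InBlock (t₀ i) (b i) then (1 : ℤ) else 0)
      (fun b _ => ite_nonneg zero_le_one le_rfl) (Finset.mem_univ b₀)
    rwa [if_pos b₀_good] at h1
  have hs : ((Equiv.Perm.sign ωSym : ℤˣ) : ℤ) * ((Equiv.Perm.sign ωSym : ℤˣ) : ℤ) = 1 := by
    rw [← Units.val_mul, Int.units_mul_self, Units.val_one]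
  set N := ∑ b : Sym → Cell, if Function.Bijective b ∧ ∀ i, InBlock (t₀ i) (b i) then (1 : ℤ) else 0
  set sg := ((Equiv.Perm.sign ωSym : ℤˣ) : ℤ)
  have hsq : sg * N * (sg * N) = N * N := by
    calc sg * N * (sg * N) = sg * sg * (N * N) := by ring
      _ = N * N := by rw [hs, one_mul]
  rw [hD, hsq]
  nlinarith [hN]


/-! ### Assembly -/

/-- **BI 2017, §3.3 (after Prop. 3.28), the `det_4` computer verification in the form
`#{even} - #{odd admissible 4-tables} > 0` — reduced to the double-Hodge-star identity (the two-level
cut theorem).** If `det K(⋆⋆μ) = det K(μ)` for all integer coefficient vectors `μ` (the determinant of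
the generic bi-alternating matrix `Σ_{A,C} μ_{AC} S_A ⊗ S_C` is invariant under the double Hodge
star), then `admissibleTableCount 4 = Σ_t D(K_{t·})² ≥ 1`. Honest: conditional on `h` AS TYPED; the
source's claim itself (`BI2017_P416_det_per`, `BI2017_latinCube_2_4`) is not discharged here.
[cite: BurgisserIkenmeyer2017, §3.3 (after Prop. 3.28)] -/
theorem admissibleTableCount_four_pos_of_detK_star
    (h : ∀ μ : Typ → ℤ, (kMat (starMu μ)).det = (kMat μ).det) : 0 < admissibleTableCount 4 := by
  have h2 := Finset.single_le_sum
    (f := fun t : Sym → Typ => Dmix (fun i => Kmat (t i)) * Dmix (fun i => Kmat (t i)))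
    (fun t _ => mul_self_nonneg _) (Finset.mem_univ t₀)
  rw [admissibleTableCount_four_eq_sum_dmix]
  simp_rw [dmix_star_eq h]
  exact lt_of_lt_of_le (lt_of_lt_of_le one_pos one_le_dmix_t₀_sq) h2


/-- **BI 2017, §3.3 "we have verified that `P_{4,16}(det_4)` [is] nonzero" — reduced to the
double-Hodge-star identity.** If `det K(⋆⋆μ) = det K(μ)` for all `μ : C(4,2)² → ℤ`, then
`P_{4,16}(det_4) ≠ 0` (the `det` half of the named fact `BI2017_P416_det_per`; by the tree's Summit-side
`BI2017_latinCube_2_4_iff_cayleyP_det_four` this is also equivalent to `BI2017_latinCube_2_4`, whose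
`n = 2` conjunct is the theorem `latinCubeCount_two_ne_zero`). Through Prop. 3.28
(`BI2017_prop_3_28_holds`: `(4!)^{16} · P_{4,16}(det_4) = admissibleTableCount 4`). Honest: conditional
on `h` AS TYPED and nothing more; VP ≠ VNP is not proved. [cite: BurgisserIkenmeyer2017, §3.3 (after Prop. 3.28)] -/
theorem cayleyP_det_four_ne_zero_of_detK_star
    (h : ∀ μ : Typ → ℤ, (kMat (starMu μ)).det = (kMat μ).det) :
    MvPolynomial.aeval (formCoeff 4 (detPoly (Fin 4) ℂ))
      (cayleyP (k := ℂ) 4 (finProdFinEquiv.symm : Fin (4 * 4) ≃ Fin 4 × Fin 4)) ≠ 0 := by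
  intro hP
  have h328 := (BI2017_prop_3_28_holds 4).1
  rw [hP, mul_zero] at h328
  have hpos := admissibleTableCount_four_pos_of_detK_star h
  have : (admissibleTableCount 4 : ℂ) ≠ 0 := by exact_mod_cast hpos.ne'
  exact this h328.symm

end Literature.Computability.AlgebraicComplexity.BI17TwoLevelCut
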